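import Summits.BirchSwinnertonDyer.Rank1Residual.X11b.AnticyclotomicControlAtoms
import HarnessLib

/-!
# X11b, route R1 — CLASS LEVEL: the control input `R1ControlOnTreeAt` (Cas18 Thm. 2.3 at every datum)
# DERIVED from the four typed JSW17 atoms, and the statement of record with (CTL) replaced by them

HONEST FRAMING (cell `b2b-bsdres`, run/shared/lean/b2b/bsd-rank1-residual/, verbatim in every
file): the goal of the cell is to DELETE the COMBINATION-SHAPED residual classes of the
Birch–Swinnerton-Dyer formula for ALL analytic-rank `≤ 1` elliptic curves over `ℚ` — "full BSD
formula for every rank `≤ 1` curve in class `C`" assembled STRICTLY from published theorems — so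
that the rank-`≤ 1` remainder becomes exactly the CONSTRUCTION-SHAPED classes, which are TYPED
(missing-input `Prop`s), NOT attempted. This is not "finishing BSD". Sub-cell
`b2b-bsdres-multr1-p1` (X11b, route R1 = Castella 2018 Thm. A re-proved along the author's
erratum); a RESEARCH ROUTE; no claim beyond the stated class; X11b stays CONSTRUCTION-SHAPED;
nothing here changes a label; no named fact is minted (two `Prop`-valued predicates with bodies —
typed SHAPES, nothing asserted — and theorems; no `sorry`).

## What this file does

* `ErratumHypotheses.natCard_endInvariants_empty_eq(_mul_prod)` — the `Σ(N⁺) → ∅` passage of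
  `AnticyclotomicSigmaPassage` on the A′-hypotheses, for every imaginary quadratic `K`, anticyclotomic
  `κ`, topological generator `γ`, degree-one `𝔭`:
  `#Sel_𝔭(K_∞, E[p^∞])^γ = #Sel_𝔭(K, E[p^∞]) · #(im loc_{Σ(N⁺)} ∩ ∏_{w∈Σ(N⁺)} ker r_w)` (NO residual
  input), `= #Sel_𝔭(K, E[p^∞]) · ∏_{w∈Σ(N⁺)} #ker r_w` given (P9).
* `R1PoitouTateAtomsAt W p` — the three Poitou–Tate atoms (P6) `BaseSelmerCountAt`, (P9) `LocSurjAt`,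
  (L10) `CoinvariantsTrivialAt` at every datum of `R1ControlOnTreeAt` (same quantifier prefix: the
  A′-hypotheses, `r_an = 1`, the non-split ramified `q`, an erratum field `K` with [Cas20 §2.5]'s
  standing hypotheses, a Heegner datum with `p ∤ c` and its point `P` of infinite order — the data
  under which JSW17's (corank 1), (sur), (irred_K) hold by Gross–Zagier–Kolyvagin — then every
  anticyclotomic `κ`, `γ`, degree-one `𝔭`, THE embedding `embAt K p 𝔭`). PUB shape; nothing asserted.
* `R1LocalKernelOrderAt W p` — the local atom (P11) at every `w ∈ Σ(N⁺)`, for every imaginary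
  quadratic `K` and anticyclotomic `κ`. PUB shape (Greenberg L3.3 / JSW Prop. 3.3.4 Case 1(a));
  nothing asserted.
* **`r1ControlOnTreeAt_of_atoms : R1PoitouTateAtomsAt W p → R1LocalKernelOrderAt W p →
  R1ControlOnTreeAt W p`** (`controlOnTreeAt_of_atoms` at every datum; `p` splits in an erratum field).
* **`R1.bsdp_of_onTree_atoms`** — route R1's statement of record with (CTL) replaced by the atoms:
  NINE PUBLISHED named facts + (P6, P9, L10) [PUB shapes, Poitou–Tate] + (P11) [PUB shape, local] +
  the ONE OPEN input `R1OpenInputOnTreeAt` ⟹ `BSD(E,p)` on `R1Population` with `r_an = 1`.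
  CONDITIONAL; deletes nothing; X11b stays CONSTRUCTION-SHAPED; no label change.

What is NOT claimed: none of (P6), (P9), (L10), (P11) is proved here. (P6), (P9), (L10) rest on
Poitou–Tate global duality (JSW17 Thm. 2.3.4; the tree vendors only the reciprocity half,
`poitouTate_sum_localTatePairing_eq_zero`); (P11) on Tate's uniformisation at a split multiplicative
`w` (tree named facts `Silverman1994_thmV53_…`) and on the finite decomposition of split primes in
`K_∞^{ac}` (class field theory).

References: [JetchevSkinnerWan2017] §3.2–3.3 (arXiv:1512.06894 pp. 10–14); [Castella2018] Thm. 2.3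
and §5 (arXiv:1704.06608 pp. 5, 12); [Castella2018Erratum] Thm. 1.1, Thm. A′ (p. 1).
-/

noncomputable section

open scoped Classical

open WeierstrassCurve NumberField IsDedekindDomain Field
open Literature.NumberTheory.EllipticCurves Literature.NumberTheory.EllipticCurves.GreenbergSelmer
open Literature.NumberTheory.EllipticCurves.ModularForms
open Literature.NumberTheory.EllipticCurves.Rank1Residual
open Literature.NumberTheory.EllipticCurves.Rank1Residual.Typed
open Literature.NumberTheory.GaloisRepresentations
open Summit.BirchSwinnertonDyer.Rank1Residual.X11b.AcSelmer

namespace Summit.BirchSwinnertonDyer.Rank1Residual.X11b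

/-! ## The `Σ(N⁺) → ∅` passage on the A′-hypotheses -/

section Passage

variable {W : WeierstrassCurve ℚ} [W.IsElliptic] [W.IsGloballyMinimal] {K : Type} [Field K]
  [NumberField K] {p : ℕ} [Fact p.Prime]

/-- **The `Σ(N⁺) → ∅` passage with NO residual input, on the A′-hypotheses**: for every imaginary
quadratic `K`, every anticyclotomic `ℤ_p`-extension `κ` with topological generator `γ`, every
degree-one `𝔭 ∣ p`:
`#Sel_𝔭(K_∞, E[p^∞])^γ = #Sel_𝔭(K, E[p^∞]) · #(im loc_{Σ(N⁺)} ∩ ∏_{w∈Σ(N⁺)} ker r_w)`.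
[cite: Castella2018, Thm. 2.3 (arXiv:1704.06608 p. 5) (shape only)] [cite: JetchevSkinnerWan2017, §3.3.4 (arXiv:1512.06894 pp. 13–14)] -/
theorem ErratumHypotheses.natCard_endInvariants_empty_eq (hE : ErratumHypotheses W p)
    (hK : IsImaginaryQuadratic K) {κ : ZpExtension K p} (hκ : κ.IsAnticyclotomic)
    {γ : absoluteGaloisGroup K} (hγ : κ.IsTopGenerator γ) (𝔭 : HeightOneSpectrum (𝓞 K))
    (h𝔭 : ((p : ℕ) : 𝓞 K) ∈ 𝔭.asIdeal) (he : 𝔭.asIdeal.ramificationIdx (𝓞 ℚ) = 1)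
    (hf : 𝔭.asIdeal.inertiaDeg (𝓞 ℚ) = 1) :
    Nat.card (IwasawaDual.endInvariants (conjSelmerAc (W.baseChange K) p κ 𝔭 ∅ γ - 1)) =
      Nat.card (selmerAcBase (W.baseChange K) p 𝔭 ∅) *
        Nat.card ↥((locSel (W.baseChange K) p 𝔭 (nPlusPlaces_finite (W := W) (p := p) hK.1)).range ⊓
          localKerPi (W.baseChange K) p κ (nPlusPlaces_finite (W := W) (p := p) hK.1)) :=
  AcSelmer.natCard_endInvariants_empty_eq (fun v hv ↦ ((mem_nPlusPlaces_iff v).mp hv).1) γ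
    (hE.controlMap_bijective_nPlus hK hκ hγ 𝔭 h𝔭 he hf)

/-- **… product form, given (P9)**: `#Sel_𝔭(K_∞, E[p^∞])^γ = #Sel_𝔭(K, E[p^∞]) · ∏_{w∈Σ(N⁺)} #ker r_w`.
[cite: Castella2018, Thm. 2.3 (arXiv:1704.06608 p. 5) (shape only)] [cite: JetchevSkinnerWan2017, Prop. 3.3.2 and §3.3.4 (arXiv:1512.06894 pp. 11–14)] -/
theorem ErratumHypotheses.natCard_endInvariants_empty_eq_mul_prod (hE : ErratumHypotheses W p)
    (hK : IsImaginaryQuadratic K) {κ : ZpExtension K p} (hκ : κ.IsAnticyclotomic)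
    {γ : absoluteGaloisGroup K} (hγ : κ.IsTopGenerator γ) (𝔭 : HeightOneSpectrum (𝓞 K))
    (h𝔭 : ((p : ℕ) : 𝓞 K) ∈ 𝔭.asIdeal) (he : 𝔭.asIdeal.ramificationIdx (𝓞 ℚ) = 1)
    (hf : 𝔭.asIdeal.inertiaDeg (𝓞 ℚ) = 1)
    (h9 : LocSurjAt (W.baseChange K) p 𝔭 (nPlusPlaces_finite (W := W) (p := p) hK.1)) :
    Nat.card (IwasawaDual.endInvariants (conjSelmerAc (W.baseChange K) p κ 𝔭 ∅ γ - 1)) =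
      Nat.card (selmerAcBase (W.baseChange K) p 𝔭 ∅) *
        ∏ v ∈ (nPlusPlaces_finite (W := W) (p := p) hK.1).toFinset,
          Nat.card (localKer κ.kerSubgroup ((W.baseChange K).geomPrimaryTorsion p) v) := by
  refine AcSelmer.natCard_endInvariants_empty_eq_mul_prod
    (fun v hv ↦ ((mem_nPlusPlaces_iff v).mp hv).1) γ (hE.controlMap_bijective_nPlus hK hκ hγ 𝔭 h𝔭 he hf) ?_
  rw [AddMonoidHom.range_eq_top.mpr h9]
  exact le_top

end Passage

/-! ## Class level -/

section ClassLevel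

/-- **The three Poitou–Tate atoms of route R1 at every datum — PUB shapes** (JSW17 Prop. 3.2.1 with
(7.1.5), Prop. 3.3.2, Lemma 3.3.3, on the constructed objects): at every datum of `R1ControlOnTreeAt`
(A′-hypotheses, `r_an = 1`, the non-split multiplicative `q ≠ p` with `E[p]` ramified, an erratum
field `K` for `q` with [Cas20 §2.5]'s standing hypotheses, a Heegner datum of level `N_E` with
`p ∤ c`, its Heegner point `P` of infinite order — so that `rank E(K) = 1`, `#Ш(E/K) < ∞` by
Gross–Zagier–Kolyvagin, i.e. JSW17's (corank 1), (sur), and (irred_K) from `Irr ∧ Ram`), for every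
anticyclotomic `κ` with topological generator `γ` and every degree-one `𝔭 ∋ p`:
(P6) `BaseSelmerCountAt p 𝔭 (embAt K p 𝔭) P`, (P9) `LocSurjAt` for `Σ(N⁺)`, (L10)
`CoinvariantsTrivialAt`. A predicate on `(W, p)`; nothing asserted; NOT a named fact (consumed as a
hypothesis). [cite: JetchevSkinnerWan2017, Prop. 3.2.1, Prop. 3.3.2, Lemma 3.3.3 (arXiv:1512.06894 pp. 10–12) (shape only; nothing asserted)]
[cite: Castella2018, Thm. 2.3 (arXiv:1704.06608 p. 5) (shape only; nothing asserted)] -/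
def R1PoitouTateAtomsAt (W : WeierstrassCurve ℚ) [W.IsElliptic] [W.IsGloballyMinimal] (p : ℕ)
    [Fact p.Prime] : Prop :=
  ∀ [NeZero (W.conductorNorm ℤ)] (q : ℕ) [Fact q.Prime] (K : Type) [Field K] [NumberField K]
    (Dt : ModularParametrizationData W (W.conductorNorm ℤ))
    (H : HeegnerDatum (W.conductorNorm ℤ) (NumberField.discr K)) (ι : K →+* ℂ)
    (P : (W.baseChange K).toAffine.Point),
    ErratumHypotheses W p → W.analyticRank = 1 → q ≠ p → Mult W q →
    ¬ W.HasSplitMultiplicativeReductionAtPrime q → ¬ p ∣ padicValInt q W.minimalDiscriminantInt →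
    ∀ hK : IsErratumField W K q, Cas20Standing K p (W.conductorNorm ℤ / p) →
    WeierstrassCurve.Affine.Point.map ι.toRatAlgHom P = heegnerPointComplex Dt H →
    ¬ (p : ℤ) ∣ Dt.c → ¬ IsOfFinAddOrder P →
    ∀ (κ : ZpExtension K p), κ.IsAnticyclotomic →
      ∀ (γ : Field.absoluteGaloisGroup K) [Fact (κ.IsTopGenerator γ)] (𝔭 : HeightOneSpectrum (𝓞 K))
        (h𝔭 : ((p : ℕ) : 𝓞 K) ∈ 𝔭.asIdeal) (he : 𝔭.asIdeal.ramificationIdx (𝓞 ℚ) = 1)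
        (hf : 𝔭.asIdeal.inertiaDeg (𝓞 ℚ) = 1),
        BaseSelmerCountAt p 𝔭 (embAt K p 𝔭 h𝔭 he hf) P ∧
          LocSurjAt (W.baseChange K) p 𝔭 (nPlusPlaces_finite (W := W) (p := p) hK.1.1) ∧
            CoinvariantsTrivialAt (W.baseChange K) p κ 𝔭 γ

/-- **The local Tamagawa atom of route R1 — PUB shape** (JSW17 Prop. 3.3.4 Case 1(a) / Greenberg
LNM 1716 pp. 74–75 on the constructed objects): for every imaginary quadratic `K`, every
anticyclotomic `ℤ_p`-extension `κ` of `K` and every `w ∈ Σ(N⁺)` (a place `w ∤ p` of `K` above a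
prime of `N_E` split in `K`, hence unramified and finitely decomposed in `K_∞^{ac}`):
`#ker(H¹(K_w, E[p^∞]) → H¹(K_{∞,η}, E[p^∞])) = c_w^{(p)}(E/K)`. A predicate on `(W, p)`; nothing
asserted; NOT a named fact. [cite: JetchevSkinnerWan2017, Prop. 3.3.4 Case 1(a) (arXiv:1512.06894 pp. 12–13) (shape only; nothing asserted)]
[cite: GreenbergLNM1716, §3 pp. 74–75 (shape only; nothing asserted)] -/
def R1LocalKernelOrderAt (W : WeierstrassCurve ℚ) (p : ℕ) [Fact p.Prime] : Prop :=
  ∀ (K : Type) [Field K] [NumberField K], IsImaginaryQuadratic K →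
    ∀ (κ : ZpExtension K p), κ.IsAnticyclotomic →
      ∀ v ∈ nPlusPlaces W K p, LocalKernelOrderAt (W.baseChange K) p κ v

variable (W : WeierstrassCurve ℚ) [W.IsElliptic] [W.IsGloballyMinimal] (p : ℕ) [Fact p.Prime]

/-- **(CTL) at class level from the atoms**: `R1PoitouTateAtomsAt W p → R1LocalKernelOrderAt W p →
R1ControlOnTreeAt W p` — Cas18 Thm. 2.3 at every datum of route R1 is the conjunction of JSW17
Prop. 3.2.1/(7.1.5), Prop. 3.3.2, Lemma 3.3.3 (Poitou–Tate) and Prop. 3.3.4 Case 1(a) (local), every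
other step of JSW §3.3 being a kernel theorem on the constructed objects (`controlOnTreeAt_of_atoms`;
`p ∣ N_E` splits in the erratum field). [cite: Castella2018, Thm. 2.3 (arXiv:1704.06608 p. 5)]
[cite: JetchevSkinnerWan2017, Thm. 3.3.1 and §3.3 (arXiv:1512.06894 pp. 11–14)] -/
theorem r1ControlOnTreeAt_of_atoms (hPT : R1PoitouTateAtomsAt W p) (hL : R1LocalKernelOrderAt W p) :
    R1ControlOnTreeAt W p := by
  intro _ q _ K _ _ Dt H ι P hE hr hqp hmq hns hvq hK hCas hP hc hinf κ hκ γ _ 𝔭 h𝔭 he hf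
  have hpN : p ∣ W.conductorNorm ℤ := dvd_conductorNorm_of_mult hE.2.1
  have hsplit : SplitsIn K p := hK.2.2.1 p (Fact.out : p.Prime) hpN (Ne.symm hqp)
  obtain ⟨h6, h9, h10⟩ := hPT q K Dt H ι P hE hr hqp hmq hns hvq hK hCas hP hc hinf κ hκ γ 𝔭 h𝔭 he hf
  exact controlOnTreeAt_of_atoms hE hK.1 hsplit hκ γ 𝔭 h𝔭 he hf (embAt K p 𝔭 h𝔭 he hf) P h6 h9 h10
    (hL K hK.1 κ hκ)

/-- **Route R1 — statement of record with (CTL) DECOMPOSED.** For every globally minimal elliptic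
`W/ℚ` and prime `p` on `R1Population` with `ord_{s=1} L(E,s) = 1`: `BSD(E,p)`, from the NINE
PUBLISHED named facts of `R1.bsdp` (Gross–Zagier 1986 I.7.3, GZK, Skinner 2016 Thm. C, modularity,
Cai–Shu–Tian 2014 Thm. 1.1, Friedberg–Hoffstein 1995 Thm. B, Mazur 1978 Cor. 4.1, Néron mapping
property), the three PUB-SHAPED Poitou–Tate atoms (P6, P9, L10: JSW17 Prop. 3.2.1, Prop. 3.3.2,
Lemma 3.3.3 on the constructed objects), the PUB-SHAPED local atom (P11: JSW17 Prop. 3.3.4 Case 1(a)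
/ Greenberg L3.3) and the ONE OPEN input `R1OpenInputOnTreeAt` ((IMC)∘(BDP) at `𝟙`: erratum Thm. 1.1
⇐ [FW21, Thm. 4.41], PREPRINT, composed with Cas18 Thm. 3.2). Everything else of Castella §5 and of
JSW17 §3.3 (the control map, its injectivity, the strict/away/infinite descents, Greenberg's Lemmas
3.1–3.3 (good, inert, ramified places), the `Σ(N⁺) → ∅` passage, the Euler-characteristic form, the
Tamagawa bookkeeping, (TAM-q), (B), (C), twist transport, the Heegner point, the Manin package) is a
tree theorem. CONDITIONAL; deletes nothing; X11b stays CONSTRUCTION-SHAPED; no label change.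
[cite: Castella2018, §5 (arXiv:1704.06608 p. 12)] [cite: Castella2018Erratum, Thm. 1.1, Thm. A′ (p. 1)]
[cite: JetchevSkinnerWan2017, Thm. 3.3.1 (arXiv:1512.06894 p. 11)] -/
theorem R1.bsdp_of_onTree_atoms
    (hGZ : GrossZagier1986_thm_I_7_3) (hGZK : rank_eq_analyticRank_of_analyticRank_le_one)
    (hSk : Skinner2016.thmC_padicValRat_bsd_rank_zero) (hmod : exists_isNewformOf)
    (hCST : CaiShuTian2014.thm11_trivialChar)
    (hFH : friedbergHoffstein_exists_twist_ne_zero_ramifiedAt)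
    (hMaz : mazur_not_dvd_maninConstant_of_odd) (hNS : integral_neronScaling_of_isGloballyMinimal)
    (hPT : ∀ (W : WeierstrassCurve ℚ) [W.IsElliptic] [W.IsGloballyMinimal] (p : ℕ) [Fact p.Prime],
      R1PoitouTateAtomsAt W p)
    (hL : ∀ (W : WeierstrassCurve ℚ) [W.IsElliptic] [W.IsGloballyMinimal] (p : ℕ) [Fact p.Prime],
      R1LocalKernelOrderAt W p)
    (hA : ∀ (W : WeierstrassCurve ℚ) [W.IsElliptic] [W.IsGloballyMinimal] (p : ℕ) [Fact p.Prime],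
      R1OpenInputOnTreeAt W p)
    (W : WeierstrassCurve ℚ) [W.IsElliptic] [W.IsGloballyMinimal] (p : ℕ) [Fact p.Prime]
    (hW : R1Population W p) (hr : W.analyticRank = 1) : BSDp W p :=
  R1.bsdp_of_onTree hGZ hGZK hSk hmod hCST hFH hMaz hNS
    (fun W _ _ p _ ↦ r1ControlOnTreeAt_of_atoms W p (hPT W p) (hL W p)) hA W p hW hr

end ClassLevel

end Summit.BirchSwinnertonDyer.Rank1Residual.X11b

end
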